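import Mathlib
import HarnessLib
import Literature.MathematicalPhysics.QuantumLattice.DWaveSourceProofs
import Literature.MathematicalPhysics.QuantumLattice.HubbardGrandCanonicalDensity

/-!
# Route `WeakCouplingBCS` — crux `WcbcsBcsConstruction` (stmt-HubbardSuperconductivity-2010),
# line `lro-seed-kink-bridge`, stub `stub_interactionComparison`

The calibration theorem "the top stairs are free-gas stairs": with
`D(U,h) = dWaveSourceDensity L U μ h` the tracial ground-state `d`-wave pair density of the sourced
grand-canonical Hubbard torus `dWaveSourceTorus L U μ h = H(1,U) - μN - h(Δ_d + Δ_d†)` on `(ℤ/Lℤ)²`,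
for `U ≤ U'` and `r > 0`

`D(U, h - r) - (U' - U)/(2r) ≤ D(U', h) ≤ D(U, h + r) + (U' - U)/(2r)`.

Proof (folklore; Koma–Tasaki 1994, §1 for the set-up). Write `E(U,h) = E₀(dWaveSourceTorus L U μ h)`.
(i) `h ↦ E(U,h)` is concave with supergradient `-2L² D(U,h)`:
`(h' - h) · 2L² D(U,h) ≤ E(U,h) - E(U,h')` (`dWaveSourceDensity_mul_le_groundEnergy_drop`).
(ii) The interaction sandwich for the SOURCED Hamiltonians: the sources cancel in the difference,
`dWaveSourceTorus L U' μ h - dWaveSourceTorus L U μ h = (U' - U) Σ_x n_{x↑} n_{x↓}`, and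
`0 ≤ Σ_x n_{x↑} n_{x↓} ≤ |Λ| = L²` as operators, so by Loewner monotonicity of the ground energy
`E(U,h) ≤ E(U',h) ≤ E(U,h) + (U' - U) L²`.
(iii) Chain (i) at coupling `U'` between `h` and `h ∓ r` with (ii) and (i) at coupling `U` between
`h ∓ r` and `h`, and divide by `2rL² > 0`.
-/

noncomputable section

set_option linter.dupNamespace false

namespace Summit.HubbardSuperconductivity.HubbardSuperconductivity.Theorems

open Literature.MathematicalPhysics.QuantumLattice Literature.Probability.LatticeModels Matrix Filter
open scoped Matrix.Norms.L2Operator ComplexOrder Topology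

/-- **The sources cancel**: the sourced torus Hamiltonians at couplings `U'` and `U` differ by the
interaction alone, `H_{U',h} - H_{U,h} = (U' - U) Σ_x n_{x↑} n_{x↓}`. [folklore] -/
theorem dWaveSourceTorus_sub_dWaveSourceTorus_coupling (L : ℕ) [NeZero L] (U U' μ h : ℝ) :
    dWaveSourceTorus L U' μ h - dWaveSourceTorus L U μ h =
      ((U' - U : ℝ) : ℂ) • ∑ x : FermionTorus 2 L, numberOp x 0 * numberOp x 1 := by
  rw [dWaveSourceTorus_eq, dWaveSourceTorus_eq, sub_sub_sub_cancel_right]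
  exact hamiltonianWith_sub_hamiltonianWith (fermionTorusGraph 2 L) 1 U U' μ

/-- **The sourced ground energy is non-decreasing in the repulsion**:
`U ≤ U' ⇒ E₀(H_{U,h}) ≤ E₀(H_{U',h})` (`Σ_x n_{x↑} n_{x↓} ≥ 0`, Loewner monotonicity).
[cite: KomaTasaki1994, §1] -/
theorem groundEnergy_dWaveSourceTorus_mono_coupling (L : ℕ) [NeZero L] (μ h : ℝ) {U U' : ℝ}
    (hU : U ≤ U') :
    (dWaveSourceTorus L U μ h).groundEnergy ≤ (dWaveSourceTorus L U' μ h).groundEnergy := by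
  refine groundEnergy_mono_of_posSemidef_sub
    (dWaveSourceTorus_isHermitian L (isHermitian_hubbardTorusWith L 1 U μ) h)
    (dWaveSourceTorus_isHermitian L (isHermitian_hubbardTorusWith L 1 U' μ) h) ?_
  rw [dWaveSourceTorus_sub_dWaveSourceTorus_coupling]
  exact (posSemidef_sum_numberOp_mul_numberOp (Λ := FermionTorus 2 L)).smul
    (Complex.zero_le_real.2 (sub_nonneg.2 hU))

/-- **… and moves by at most `(U' - U) L²`**: `E₀(H_{U',h}) ≤ E₀(H_{U,h}) + (U' - U) L²` for
`U ≤ U'` (`Σ_x n_{x↑} n_{x↓} ≤ |Λ| = L²`). [cite: KomaTasaki1994, §1] -/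
theorem groundEnergy_dWaveSourceTorus_le_add_coupling (L : ℕ) [NeZero L] (μ h : ℝ) {U U' : ℝ}
    (hU : U ≤ U') :
    (dWaveSourceTorus L U' μ h).groundEnergy ≤
      (dWaveSourceTorus L U μ h).groundEnergy + (U' - U) * (L : ℝ) ^ 2 := by
  have key : (dWaveSourceTorus L U' μ h).groundEnergy ≤
      (dWaveSourceTorus L U μ h).groundEnergy + (U' - U) * Fintype.card (FermionTorus 2 L) := by
    refine groundEnergy_le_add_of_sub_le_smul
      (dWaveSourceTorus_isHermitian L (isHermitian_hubbardTorusWith L 1 U μ) h)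
      (dWaveSourceTorus_isHermitian L (isHermitian_hubbardTorusWith L 1 U' μ) h) ?_
    rw [dWaveSourceTorus_sub_dWaveSourceTorus_coupling]
    have := (posSemidef_card_sub_sum_numberOp_mul_numberOp (Λ := FermionTorus 2 L)).smul
      (Complex.zero_le_real.2 (sub_nonneg.2 hU))
    rw [smul_sub, smul_smul, ← Complex.ofReal_natCast, ← Complex.ofReal_mul] at this
    -- the two sides differ only in the `DecidableEq` instance carried by `1`
    convert this
  rw [card_fermionTorus 2] at key
  push_cast at key
  exact key

/-- **Stub `stub_interactionComparison`** of the line `lro-seed-kink-bridge` (crux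
`WcbcsBcsConstruction`): the sourced `d`-wave pair density at coupling `U'` is sandwiched by the one
at any smaller coupling `U ≤ U'` at sources shifted by `∓ r`, up to `(U' - U)/(2r)`:
`D(U, h - r) - (U' - U)/(2r) ≤ D(U', h) ≤ D(U, h + r) + (U' - U)/(2r)` for every `L`, `μ`, real `h`
and `r > 0` (supergradient inequality of the concave sourced ground energy + the interaction
sandwich `E(U,h) ≤ E(U',h) ≤ E(U,h) + (U' - U)L²`). [cite: KomaTasaki1994, §1] -/
theorem stub_interactionComparison :
    ∀ (L : ℕ) [NeZero L] (U U' μ h r : ℝ), U ≤ U' → 0 < r →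
      dWaveSourceDensity L U μ (h - r) - (U' - U) / (2 * r) ≤ dWaveSourceDensity L U' μ h ∧
      dWaveSourceDensity L U' μ h ≤ dWaveSourceDensity L U μ (h + r) + (U' - U) / (2 * r) := by
  intro L _ U U' μ h r hU hr
  have hL := cast_sq_pos_of_neZero L
  have h2rL : (0 : ℝ) < 2 * r * (L : ℝ) ^ 2 := by positivity
  have hc : (U' - U) / (2 * r) * (2 * r * (L : ℝ) ^ 2) = (U' - U) * (L : ℝ) ^ 2 := by
    field_simp
  -- (i) the supergradient inequalities at couplings `U'` and `U`
  have i1 := dWaveSourceDensity_mul_le_groundEnergy_drop (L := L) U' μ h (h - r)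
  have i2 := dWaveSourceDensity_mul_le_groundEnergy_drop (L := L) U μ (h - r) h
  have i3 := dWaveSourceDensity_mul_le_groundEnergy_drop (L := L) U' μ h (h + r)
  have i4 := dWaveSourceDensity_mul_le_groundEnergy_drop (L := L) U μ (h + r) h
  -- (ii) the interaction sandwich for the sourced Hamiltonians
  have s1 := groundEnergy_dWaveSourceTorus_mono_coupling L μ (h - r) hU
  have s2 := groundEnergy_dWaveSourceTorus_le_add_coupling L μ h hU
  have s3 := groundEnergy_dWaveSourceTorus_mono_coupling L μ (h + r) hU
  constructor
  · refine le_of_mul_le_mul_right ?_ h2rL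
    rw [sub_mul, hc]
    linarith
  · refine le_of_mul_le_mul_right ?_ h2rL
    rw [add_mul, hc]
    linarith

end Summit.HubbardSuperconductivity.HubbardSuperconductivity.Theorems

end
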